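import Mathlib
import HarnessLib
import Summits.QuantumFields.QCD.Theses.NestedDissectionSea
import Literature.Barriers.QuantumFields.WilsonDeterminantSign

/-!
# Crux-ideate sketches for `NestedDissectionSea.LightQuarkCompletion` (stmt-QuantumFields-18066), ideator 2, round 1

First lemmas of the two idea cards (they must elaborate; proofs are not required at this stage):

* `FeshbachZeroTransport` — card `feshbach-edge-transport`: the Feshbach–Schur projection of the
  Wilson operator onto ANY "low" index block transports zeros exactly (the full operator is singular
  iff the Schur complement onto the low block is) and the low–low block of the propagator IS the
  inverse Schur complement (Banachiewicz). Exact linear algebra over the tree's `wilsonDirac`.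
* `TwistedResolventIdentity` — card `twisted-pcvc-goldstone-squeeze`: the configuration-wise
  twisted-mass PCVC/GMOR identity `tr Γ₅(D_W+iμΓ₅)⁻¹ − tr Γ₅(D_W−iμΓ₅)⁻¹ = −2iμ ‖(D_W+iμΓ₅)⁻¹‖²_HS`
  together with positivity of the two-flavour twisted weight `det(D_W+iμΓ₅)·det(D_W−iμΓ₅) > 0`.
-/

namespace Summit.QuantumFields.QCD.Cruxes.LightQuarkCompletion.SketchIdeator2

open scoped BigOperators Classical Matrix ComplexConjugate
open Literature.MathematicalPhysics.QuantumLattice Literature.MathematicalPhysics.QuantumFieldTheory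
  Literature.Probability.LatticeModels

/-- **Card A, first lemma (exact part). FESHBACH ZERO-TRANSPORT for the Wilson operator.**
For every odd or even torus, every `SU(3)` field, every bare mass `μ` and every index predicate
`low` (think: the block-constant / coarse modes at a physical scale `ℓ`) whose complementary block
`hi := ¬ low` of `D = wilsonDirac … U μ 1` is invertible (no "ultraviolet" zero mode):
(i) `D` is singular iff its Schur complement `F = D_ll − D_lh D_hh⁻¹ D_hl` onto the low block is
singular — so every real-eigenvalue CROSSING of the route's parity pin is a zero of the ONE
effective coarse operator family `μ ↦ F(μ)`; (ii) when `D` is invertible the low–low block of the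
quark propagator `D⁻¹` equals `F⁻¹` — so long-distance (pion) propagation between coarse modes is
governed by the SAME family. -/
def FeshbachZeroTransport : Prop :=
  ∀ (N : ℕ) [NeZero N] (U : GaugeConfig 4 N (Matrix.specialUnitaryGroup (Fin 3) ℂ)) (μ : ℝ)
    (low : TorusSite 4 N × Fin 3 × Fin 4 → Prop),
    let D : Matrix (TorusSite 4 N × Fin 3 × Fin 4) (TorusSite 4 N × Fin 3 × Fin 4) ℂ :=
      wilsonDirac (fundamentalRep (Fin 3)) U μ 1
    let hi : TorusSite 4 N × Fin 3 × Fin 4 → Prop := fun p => ¬ low p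
    IsUnit (D.toBlock hi hi).det →
      let F := D.toBlock low low - D.toBlock low hi * (D.toBlock hi hi)⁻¹ * D.toBlock hi low
      (D.det = 0 ↔ F.det = 0) ∧ (IsUnit D.det → (D⁻¹).toBlock low low = F⁻¹)

/-- The abstract algebra behind (i): for a square matrix `M` and a predicate `p` with invertible
complementary block, `det M = 0 ↔ det (Schur complement onto p) = 0`. -/
theorem det_eq_zero_iff_schur {m : Type*} [Fintype m] [DecidableEq m] (p : m → Prop) [DecidablePred p]
    (M : Matrix m m ℂ) (hD : IsUnit (M.toBlock (fun j => ¬ p j) (fun j => ¬ p j)).det) :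
    M.det = 0 ↔
      (M.toBlock p p - M.toBlock p (fun j => ¬ p j) * (M.toBlock (fun j => ¬ p j) (fun j => ¬ p j))⁻¹ *
        M.toBlock (fun j => ¬ p j) p).det = 0 := by
  have hinv : Invertible (M.toBlock (fun j => ¬ p j) (fun j => ¬ p j)) :=
    Matrix.invertibleOfIsUnitDet _ hD
  rw [Matrix.det_toBlock M p, Matrix.det_fromBlocks₂₂, Matrix.invOf_eq_nonsing_inv, mul_eq_zero]
  constructor
  · rintro (h | h)
    · exact absurd h hD.ne_zero
    · exact h
  · intro h
    exact Or.inr h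

/-- **Card B, first lemma (exact part). TWISTED RESOLVENT / PCVC–GMOR IDENTITY, configuration-wise.**
For `D = D_W(U, m₀, r = 1)` (any torus, any `SU(3)` field, ANY untwisted bare mass `m₀`, e.g. the
parity-jump line), `Γ = Γ₅` and a twisted mass `μ ≠ 0`, put `A = D + iμΓ`, `B = D − iμΓ` (the two
flavours of a maximally/arbitrarily twisted doublet). Then `A`, `B` are invertible, the two-flavour
weight `det A · det B` is real positive (no sign problem, no exceptional configuration), and
`tr(Γ A⁻¹) − tr(Γ B⁻¹) = −2iμ · tr(A⁻¹ (A⁻¹)ᴴ)`: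
the left side is (i·volume ×) the twisted condensate `⟨ψ̄ iγ₅τ³ ψ⟩` of the configuration, the right
side is `−2iμ ×` the charged-pion correlator summed over both endpoints (a Hilbert–Schmidt norm,
Weingarten-positive). In eigenvalues `h_i` of `H_W(m₀) = Γ D`: both sides equal
`−2iμ Σ_i (h_i² + μ²)⁻¹` — simultaneously the exact lattice PCVC sum rule of tmQCD
(`∂_μ Ṽ^a_μ = −2μ ε^{3ab} P^b`, `Z_V = 1`) and Banks–Casher for the HERMITIAN Wilson operator. -/
def TwistedResolventIdentity : Prop :=
  ∀ (N : ℕ) [NeZero N] (U : GaugeConfig 4 N (Matrix.specialUnitaryGroup (Fin 3) ℂ)) (m₀ μ : ℝ),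
    μ ≠ 0 →
    let D : Matrix (TorusSite 4 N × Fin 3 × Fin 4) (TorusSite 4 N × Fin 3 × Fin 4) ℂ :=
      wilsonDirac (fundamentalRep (Fin 3)) U m₀ 1
    let Γ : Matrix (TorusSite 4 N × Fin 3 × Fin 4) (TorusSite 4 N × Fin 3 × Fin 4) ℂ :=
      spinorLift gammaFive
    let A := D + ((Complex.I * (μ : ℂ)) • Γ)
    let B := D - ((Complex.I * (μ : ℂ)) • Γ)
    IsUnit A.det ∧ IsUnit B.det ∧ (A.det * B.det).im = 0 ∧ 0 < (A.det * B.det).re ∧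
      (Γ * A⁻¹).trace - (Γ * B⁻¹).trace = -(2 * Complex.I * (μ : ℂ)) * (A⁻¹ * (A⁻¹)ᴴ).trace

/-- The abstract algebra behind the identity: for ANY square matrices with `A − B = c • Γ`,
`Γ * Γ = 1`, `A`, `B` invertible and `Γ * B⁻¹ = (A⁻¹)ᴴ * Γ` (γ₅-hermiticity),
`tr(Γ A⁻¹) − tr(Γ B⁻¹) = −c · tr(A⁻¹ (A⁻¹)ᴴ)`. -/
theorem trace_resolvent_diff {m : Type*} [Fintype m] [DecidableEq m]
    (A B Γ : Matrix m m ℂ) (c : ℂ) (hA : IsUnit A.det) (hB : IsUnit B.det)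
    (hdiff : A - B = c • Γ) (hΓ : Γ * Γ = 1) (hherm : Γ * B⁻¹ = (A⁻¹)ᴴ * Γ) :
    (Γ * A⁻¹).trace - (Γ * B⁻¹).trace = -c * (A⁻¹ * (A⁻¹)ᴴ).trace := by
  -- A⁻¹ − B⁻¹ = A⁻¹ (B − A) B⁻¹ = −c • A⁻¹ Γ B⁻¹
  have hAB : A⁻¹ - B⁻¹ = -c • (A⁻¹ * Γ * B⁻¹) := by
    have h1 : A⁻¹ * (B - A) * B⁻¹ = A⁻¹ - B⁻¹ := by
      rw [Matrix.mul_sub, Matrix.sub_mul, Matrix.nonsing_inv_mul _ hA, Matrix.one_mul,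
        Matrix.mul_assoc, Matrix.mul_nonsing_inv _ hB, Matrix.mul_one]
    have h2 : B - A = -c • Γ := by
      rw [← neg_sub, hdiff, neg_smul]
    rw [← h1, h2, Matrix.mul_smul, Matrix.smul_mul]
  have key : A⁻¹ * Γ * (B⁻¹ * Γ) = A⁻¹ * (A⁻¹)ᴴ := by
    calc A⁻¹ * Γ * (B⁻¹ * Γ) = A⁻¹ * (Γ * B⁻¹) * Γ := by simp only [Matrix.mul_assoc]
      _ = A⁻¹ * ((A⁻¹)ᴴ * Γ) * Γ := by rw [hherm]
      _ = A⁻¹ * (A⁻¹)ᴴ * (Γ * Γ) := by simp only [Matrix.mul_assoc]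
      _ = A⁻¹ * (A⁻¹)ᴴ := by rw [hΓ, Matrix.mul_one]
  calc (Γ * A⁻¹).trace - (Γ * B⁻¹).trace
      = (Γ * (A⁻¹ - B⁻¹)).trace := by rw [Matrix.mul_sub, Matrix.trace_sub]
    _ = (Γ * (-c • (A⁻¹ * Γ * B⁻¹))).trace := by rw [hAB]
    _ = -c * (Γ * (A⁻¹ * Γ * B⁻¹)).trace := by rw [Matrix.mul_smul, Matrix.trace_smul, smul_eq_mul]
    _ = -c * (A⁻¹ * Γ * B⁻¹ * Γ).trace := by rw [Matrix.trace_mul_comm]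
    _ = -c * (A⁻¹ * (A⁻¹)ᴴ).trace := by rw [Matrix.mul_assoc (A⁻¹ * Γ) B⁻¹ Γ, key]

end Summit.QuantumFields.QCD.Cruxes.LightQuarkCompletion.SketchIdeator2
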